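import Summits.AtomisticToContinuum.Crystallization.Theorems.OverbindingBudgetAffineNearCriticalRecord

/-!
# Overbinding budget — the SKELETON EQUILIBRIUM: RD0c ⟸ CP ∧ R0 (decomp-a2c lens-4 g45; v2 = g46 RE-CUT of the skeleton, critic row 692)

Sibling of `…Theorems.OverbindingBudgetAffineNearCritical` (tree, p840788).  That file typed the critical-reference line RD0c
`NearReferenceCriticalFloor η R Rc δm ρ₁ θ θ₀ κ₁` of the near-regime crux as ONE existential statement («there is an admissible reference ẑ
with `firstSum = 0` whose order 0 is floored»).  This node fixes THE object and splits RD0c into the two statements about it that the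
critic endorsed (rows 670 (4)(5), 677 (c)); v2 re-cuts the object after the reviewer's junk-model finding (q15651922, upheld in row 692: v1's
fatness clause admitted free DUST — balls of radius `ℓ/8` on a `0.9ℓ`-net — leaving ≥ 98 % of deep near matter pinned raw, so v1's R0 contained
N's raw floor in substance).

THE OBJECT (the lens's normal form — a counterexample to the near floor reduces to an EQUILIBRIUM one).  For an injective `y` let
`I := nearInterior Rc` be the clampable near sites (all sites within `Rc·nn` are near; `RefAdmissible` (b)).  A CELL SKELETON of scale `ℓ`, gap `t`,
wall half-width `w` is a free set `F ⊆ I` cut by a labelling into CELLS with: (2) every cell of `y`-diameter `≤ ℓ`; (3) distinct cells `≥ t` apart;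
(4) FAT-OR-PERIPHERAL — every free site lies within `ℓ` of a non-clampable site, or its cell contains a full ball (all sites within `ℓ/8` of one of
its free sites are free and in the same cell); (5) THIN WALLS — every PINNED clampable site lies within `ℓ` of a non-clampable site (the collar) or
within `w` of free sites of TWO DISTINCT cells; (6) SPARSE WALLS — around every `2ℓ`-deep clampable site at most the fraction `8w/ℓ` of the sites
within `ℓ` is pinned (`CellSkeleton`).  What v2 quantifies over is therefore: fat cells of inradius `≥ ℓ/8` and diameter `≤ ℓ` filling the `ℓ`-deep
near matter up to two-sided pinned walls of thickness in `[t, 2w)` and local volume fraction `≤ 8w/ℓ`, plus an `ℓ`-collar at the near boundary —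
the four junk models (stranded pinned bulk or dust, one-sided pins inside a cell, foams of thin cells, interdigitated combs / dense walls) are
REFUTED AS SKELETONS by the proved lemmas `not_cellSkeleton_of_stranded_pinned`, `not_cellSkeleton_of_oneSided_pinned`,
`not_cellSkeleton_of_thin_deep_cell`, `not_cellSkeleton_of_dense_pinned`, and `F = ∅` is a skeleton iff
the clampable interior is `ℓ`-THIN (`cellSkeleton_empty`, `nearInterior_thin_of_cellSkeleton_empty`, both directions proved) — the
boundary-dominated case, where every near site is within `ℓ + Rc + 1` of far/bad matter and the raw sitewise loss `≤ C·ε₁` per near site is charged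
to `κ₁·#Far + C·#Gᶜ` with `ε₀ = ε₀(ℓ)` (so NOT the zero-budget bulk regime that makes N hard).  The SKELETON EQUILIBRIUM is a configuration `z` with
`z = y` off `F` and vanishing CLASS FORCE `classForce Near G z k = 2·∂Φ_y/∂z_k = 0` at every `k ∈ F`, `Φ_y(z) := ½·pairSum (Near y) (G y) z`
(`ClassCritical`).  Because the displacement `y − z` lives on `F` and the class force vanishes on `F`, the first order of the class sum VANISHES
IDENTICALLY — the PROVED algebraic identity `firstSum_eq_sum_inner_classForce` (`firstSum S T y z = Σ_k ⟪y k − z k, classForce S T z k⟫`, Abel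
resummation of the ordered double sum) and its corollary `firstSum_eq_zero_of_classCritical`.  Walls are codimension-one on purpose: isolated
point pins are capacity-soft in three dimensions (the pinned equilibrium spikes at them and admissibility fails), planes/walls are hard; the gap `t`
makes distinct cells interact only through Lennard-Jones tails (`|V″(r)| ≤ 7 r⁻⁸`), which is what makes CP finite-dimensional cell by cell.
LITERALS: record `(t, w) = (4, 6)`; `w = 6 (= Rc)` and not `w = t`: a pinned slab `{0 < s < T}` between two cells has all its sites within
`T + 2·(covering radius) ≤ T + 3/2` of BOTH cells only if `w ≥ T + 3/2`, and clause (3) needs `T ≥ t = 4`; `w = 6` admits `T ∈ [4, 9/2]`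
in every wall orientation of bent close-packed matter (covering radius `< 3/4`), `w = 4` admits none.

* CP · `NearSkeletonEquilibrium η R Rc δm ρ₁ θ θ₀ t w` [NEW · TRUE-type · ATTACKABLE-M] — given the K-margins and R_aff: for every scale
  `ℓ ≥ ℓ₁` there is `ε₀(ℓ) > 0` such that every injective `y` (all `ε₁ ≤ ε₀`, all windows) admits a cell skeleton `F` of scale `ℓ` and a skeleton
  equilibrium `z` on it which is `RefAdmissible`.  Skeleton (v2): pinned slabs `{0 < s < 43/10}` along the three families of a cubic grid of
  spacing `ℓ/3`; cells := the clampable sites of every open grid cube that contains a site deeper than `ℓ − 6` (each such cell contains the full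
  `ℓ/8`-ball about a site within `3/4` of the cube centre once `ℓ ≥ 72`, and has diameter `≤ (ℓ/3)·√3 ≤ ℓ`); every other clampable site is pinned
  and is either a slab/junction site between two cells (within `43/10 + 3/2 ≤ 6 = w` of both) or within `(ℓ − 6) + 6 = ℓ` of a non-clampable site;
  slab sites are the fraction `≈ 9·(43/10)/ℓ ≤ 8w/ℓ` of every `ℓ`-ball about a `2ℓ`-deep site.
  Equilibrium: minimise `Φ_y` over the compact convex set {`z = y` off `F`, relative bond displacement `≤ s·|bond|` on class bonds} (`s ≤ δm` small
  enough that every member is `η`-charted along the segment, from `y`'s `θ₀ + Cε₁` charts and R_aff); forces of registered near matter are `O(ε₁)`;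
  the cells are `t`-separated, so the Hessian is block-diagonally dominant over cells (off-diagonal blocks are LJ tails) and K_at⁰ on each cell
  (a finite window, the test field vanishing on the walls) gives the a-priori bound `sup |∇(z − y)| ≤ C ε₁ ℓ⁴ / μ₁ < s` UNIFORMLY IN `N` — the
  minimiser is interior, hence class-critical on `F`; (c),(d) of `RefAdmissible` follow from the same smallness.  Every constant may be
  polynomial in `ℓ`, because `ε₀` is chosen after `ℓ`.  WHY IT MIGHT FAIL: only through the chart clause (d) — the room `η − θ₀ − Cε₁` for the
  perturbation must be positive at the record `(η, θ₀) = (3/2000, 1/2000)` with file A's chart constant `C`.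
* R0 · `NearSkeletonFloor η R Rc δm ρ₁ θ θ₀ κ₁ t w` [NEW · TRUE-type on paper · ATTACKABLE-L · UNDECIDED — test = census (B)(iii) re-pointed +
  the wall-load rows of the g46 memo] — the ORDER-0 FLOOR OF SKELETON EQUILIBRIA: for every `ν > 0` there is a scale `ℓ₀(ν)` such that for
  `ℓ ≥ ℓ₀`, `ε₁ ≤ ε₀(ℓ)`: every admissible skeleton equilibrium `(F, z)` of every injective `y` satisfies
  `#Near·e⋆ − C·#Gᶜ − κ₁·#Far − ν·Q₁(y, z) ≤ ½·pairSum Near G z`.  By (4)–(6) the configurations floored are RELAXED on fat cells filling the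
  `ℓ`-deep near matter and RAW only on two-sided walls of thickness `< 2w` and local volume fraction `≤ 8w/ℓ` between cells and on the `ℓ`-collar.  Route (g45 memo §3): sitewise affine
  equation of state `W(B_k) ≥ e⋆ + c_W|E_k|²` with force-weighted per-site charts on the de-jittered configuration (first order `≡ 0` SITEWISE);
  wall-jitter bumps are signed by K_at⁰ at the de-jittered configuration; every remaining leak is quadratic in the wall KINKS `J` (charged to
  `ν·Q₁` by surface-to-volume once `ℓ ≥ ℓ₀(ν)`), in the curvature `K ≤ Cε₁`, or sits on the collar (`#collar ≤ C(ℓ)(#Far + #Gᶜ)`, `ε₀(ℓ)`).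
  WHY IT MIGHT FAIL (g46 sharpening): `y`-features of thickness `d ≲ 10` ADJACENT to a wall (a thin loaded layer, a fold line meeting the wall)
  produce wall reactions `≈ f·d/t` per wall site whose cross term with the wall jitter is bounded by AM–GM only up to a factor `c/(2μ₁ t d)` of the
  load-induced strain surplus, and kink losses `|G|J²ℓ²/t` against a slab surplus `c J² d ℓ²` (ratio `c d t/|G|`): an `O(1)`-constant regime, not
  a parameter regime — the statement may still hold there (the true second variation of the jitter is positive), the g45 bookkeeping does not
  decide it.
* SEAM `nearReferenceCritical_of_skeleton : K-side → CP → R0 → RD0c` PROVED (ℓ := max ℓ₀ ℓ₁, ε₀ := min, `firstSum = 0` by the identity);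
  record cone `tbdsg_of_nearSkeleton_record` at `(η, R, Rc, δm, ρ₁, θ, θ₀, κ₁, t, w) = (3/2000, 4, 6, 1/1000, 12, 1/25, 1/2000, 1/(4·10⁷), 4, 6)`
  through the tree's cone of record `tbdsg_of_nearCritical_record'_bt_d` (p840951, BT and D discharged): the slot-3 LINE cone reads
  `K_at⁰ ∧ R_aff ∧ CP ∧ R0 ∧ N2 ∧ Z ∧ M ⟹ TBDSG_rec` (the cone OF RECORD stays `tbdsg_of_nearCritical_record'_bt_d`, row 686 (c)).
* NEITHER PIECE IS THE TARGET REWORDED: CP has no floor; R0 floors the REFERENCE'S class sum `½·pairSum Near G z`, not `y`'s, and `z = y` on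
  `ℓ`-deep near matter is an instance only where `y` is ITSELF class-critical on fat cells (the lens's normal form) — pinned deep matter cannot
  be bulk, dust, one-sided, foam or comb (the four exclusion lemmas), only sparse walls between distinct fat cells; neither piece is implied by N's conclusion
  nor implies RD0c alone (probes `HOME/decomp-a2c-lens-4/g46/bc/probes.lean`).

sorry-free · Mathlib + tree only · no new axioms.  Memos: `HOME/decomp-a2c-lens-4/g45/memo/NODE-g45-SkeletonEquilibrium.md`,
`HOME/decomp-a2c-lens-4/g46/memo/DELTA-g46-SkeletonRecut.md`.
-/

namespace Summit.AtomisticToContinuum.Crystallization.Theorems.OverbindingBudgetAffineNearCluster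

open scoped BigOperators Classical
open Literature.MathematicalPhysics.StatisticalMechanics
open Literature.Geometry.DiscreteGeometry (nearestDist)
open Summit.AtomisticToContinuum.Crystallization.Theses.OverbindingBudget (RobustDefectLimitWindows)
open Summit.AtomisticToContinuum.Crystallization.Theses.PricedLinkCensus (ChargedEnergyGap)
open Summit.AtomisticToContinuum.Crystallization.Theorems.OverbindingBudgetGradedBareness (CleanlessExcessT)
open Summit.AtomisticToContinuum.Crystallization.Theorems.OverbindingBudgetCoherentCut (CoherentResidual)
open Summit.AtomisticToContinuum.Crystallization.Theorems.OverbindingBudgetTwoShellShape (TwoShellShape)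
open Summit.AtomisticToContinuum.Crystallization.Theorems.OverbindingBudgetBalancedCensusStatements
open Summit.AtomisticToContinuum.Crystallization.Theorems.OverbindingBudgetBalancedCensusRecord
open Summit.AtomisticToContinuum.Crystallization.Theorems.OverbindingBudgetHarmonicNormalForm
open Summit.AtomisticToContinuum.Crystallization.Theorems.OverbindingBudgetLocalHarmonicCertificate
open Summit.AtomisticToContinuum.Crystallization.Theorems.OverbindingBudgetAffineLadder
open Summit.AtomisticToContinuum.Crystallization.Theorems.OverbindingBudgetAffineLocalisation

variable {N : ℕ}
local notation "E3" => EuclideanSpace ℝ (Fin 3)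

/-! ## §1  The class force and the first-order identity (PROVED) -/

/-- **Class force** of the class energy `Φ(z) = ½·pairSum S T z` at the site `k`: `classForce S T z k = 2·∂Φ/∂z_k`, i.e. the sum of
`V′(|b|)·b̂` over the ordered class bonds ending at `k` (as a `T`-end of bonds from `S`, minus as an `S`-end of bonds into `T`). [this file] -/
noncomputable def classForce (S T : Finset (Fin N)) (z : Fin N → E3) (k : Fin N) : E3 :=
  (∑ i ∈ S, if k ∈ T then (ljD1 ‖z k - z i‖ / ‖z k - z i‖) • (z k - z i) else 0)
    - (if k ∈ S then ∑ j ∈ T, (ljD1 ‖z j - z k‖ / ‖z j - z k‖) • (z j - z k) else 0)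

/-- Abel resummation, first half: the `T`-ends. [this file] -/
theorem sum_inner_classForce_fst (S T : Finset (Fin N)) (w z : Fin N → E3) :
    ∑ k, inner ℝ (w k) (∑ i ∈ S, if k ∈ T then (ljD1 ‖z k - z i‖ / ‖z k - z i‖) • (z k - z i) else 0)
      = ∑ i ∈ S, ∑ j ∈ T, inner ℝ (w j) ((ljD1 ‖z j - z i‖ / ‖z j - z i‖) • (z j - z i)) := by
  calc ∑ k, inner ℝ (w k) (∑ i ∈ S, if k ∈ T then (ljD1 ‖z k - z i‖ / ‖z k - z i‖) • (z k - z i) else 0)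
      = ∑ k, (if k ∈ T then ∑ i ∈ S, inner ℝ (w k) ((ljD1 ‖z k - z i‖ / ‖z k - z i‖) • (z k - z i)) else 0) := by
          refine Finset.sum_congr rfl fun k _ => ?_
          by_cases hk : k ∈ T
          · simp only [hk, if_true, inner_sum]
          · simp [hk]
    _ = ∑ k ∈ T, ∑ i ∈ S, inner ℝ (w k) ((ljD1 ‖z k - z i‖ / ‖z k - z i‖) • (z k - z i)) := by
          rw [← Finset.sum_filter]
          exact Finset.sum_congr (by ext k; simp) fun _ _ => rfl
    _ = ∑ i ∈ S, ∑ j ∈ T, inner ℝ (w j) ((ljD1 ‖z j - z i‖ / ‖z j - z i‖) • (z j - z i)) := Finset.sum_comm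

/-- Abel resummation, second half: the `S`-ends. [this file] -/
theorem sum_inner_classForce_snd (S T : Finset (Fin N)) (w z : Fin N → E3) :
    ∑ k, inner ℝ (w k) (if k ∈ S then ∑ j ∈ T, (ljD1 ‖z j - z k‖ / ‖z j - z k‖) • (z j - z k) else 0)
      = ∑ i ∈ S, ∑ j ∈ T, inner ℝ (w i) ((ljD1 ‖z j - z i‖ / ‖z j - z i‖) • (z j - z i)) := by
  calc ∑ k, inner ℝ (w k) (if k ∈ S then ∑ j ∈ T, (ljD1 ‖z j - z k‖ / ‖z j - z k‖) • (z j - z k) else 0)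
      = ∑ k, (if k ∈ S then ∑ j ∈ T, inner ℝ (w k) ((ljD1 ‖z j - z k‖ / ‖z j - z k‖) • (z j - z k)) else 0) := by
          refine Finset.sum_congr rfl fun k _ => ?_
          by_cases hk : k ∈ S
          · simp only [hk, if_true, inner_sum]
          · simp [hk]
    _ = ∑ i ∈ S, ∑ j ∈ T, inner ℝ (w i) ((ljD1 ‖z j - z i‖ / ‖z j - z i‖) • (z j - z i)) := by
          rw [← Finset.sum_filter]
          exact Finset.sum_congr (by ext k; simp) fun _ _ => rfl

/-- **The class force is the gradient of the class sum (PROVED):** `Σ_k ⟪w k, classForce S T z k⟫ = Σ_{i∈S, j∈T} (V′(|b|)/|b|)·⟪b, w j − w i⟫`,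
`b = z j − z i`. [this file] -/
theorem sum_inner_classForce (S T : Finset (Fin N)) (w z : Fin N → E3) :
    ∑ k, inner ℝ (w k) (classForce S T z k)
      = ∑ i ∈ S, ∑ j ∈ T, (ljD1 ‖z j - z i‖ / ‖z j - z i‖) * inner ℝ (z j - z i) (w j - w i) := by
  unfold classForce
  simp_rw [inner_sub_right, Finset.sum_sub_distrib, sum_inner_classForce_fst, sum_inner_classForce_snd,
    ← Finset.sum_sub_distrib]
  refine Finset.sum_congr rfl fun i _ => Finset.sum_congr rfl fun j _ => ?_
  rw [← inner_sub_left, real_inner_smul_right, real_inner_comm, inner_sub_right]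

/-- **FIRST-ORDER IDENTITY (PROVED):** `firstSum S T y z = Σ_k ⟪y k − z k, classForce S T z k⟫` — the first order of the class sum is the
class force paired with the displacement `y − z`. [this file] -/
theorem firstSum_eq_sum_inner_classForce (S T : Finset (Fin N)) (y z : Fin N → E3) :
    firstSum S T y z = ∑ k, inner ℝ (y k - z k) (classForce S T z k) := by
  rw [sum_inner_classForce]
  unfold firstSum
  refine Finset.sum_congr rfl fun i _ => Finset.sum_congr rfl fun j _ => ?_
  have hv : (y j - y i) - (z j - z i) = (y j - z j) - (y i - z i) := by abel
  rw [hv]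
  ring

/-- **Critical references have no first order (PROVED):** if `y − z` is supported in `F` and the class force of `z` vanishes on `F`, then
`firstSum S T y z = 0`. [this file] -/
theorem firstSum_eq_zero_of_classCritical {S T F : Finset (Fin N)} {y z : Fin N → E3}
    (hsupp : ∀ k, y k ≠ z k → k ∈ F) (hcrit : ∀ k ∈ F, classForce S T z k = 0) : firstSum S T y z = 0 := by
  rw [firstSum_eq_sum_inner_classForce]
  refine Finset.sum_eq_zero fun k _ => ?_
  by_cases hk : k ∈ F
  · rw [hcrit k hk, inner_zero_right]
  · have hyz : y k = z k := by
      by_contra h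
      exact hk (hsupp k h)
    rw [hyz, sub_self, inner_zero_left]

/-! ## §2  The skeleton equilibrium (THE object) -/

/-- **The clampable near interior** `nearInterior Rc`: near sites all of whose sites within `Rc · nn` are near (exactly the sites at which
`RefAdmissible` (b) allows `z ≠ y`). [this file] -/
noncomputable def nearInterior (Rc θ₀ ρ₁ ε₁ θ δ : ℝ) (y : Fin N → E3) : Finset (Fin N) :=
  (nearSet θ₀ ρ₁ ε₁ θ δ y).filter fun i => ∀ j, dist (y j) (y i) ≤ Rc * nearestDist y i → j ∈ nearSet θ₀ ρ₁ ε₁ θ δ y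

/-- **Cell skeleton** (v2, lens-4 g46 re-cut; critic row 692) of scale `ℓ`, gap `t`, wall half-width `w` (distances in `y`; near matter has
`nn ∈ [0.956, 1]`): the free set `F` lies in the clampable near interior `I := nearInterior Rc`, and a labelling `c` cuts it into CELLS with
(2) every cell of `y`-diameter `≤ ℓ`; (3) distinct cells `≥ t` apart (cells interact only through Lennard-Jones tails — CP's
finite-dimensionality); (4) FAT-OR-PERIPHERAL: every free site lies within `ℓ` of a non-clampable site, or its cell contains a FULL BALL — all
sites within `ℓ/8` of some free site `m` of the same cell are free and in that cell (no foams of thin cells in deep near matter); (5) THIN WALLS: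
every PINNED clampable site lies within `ℓ` of a non-clampable site (the collar, chargeable to far/bad matter at rate `C(ℓ)·ε₁`), or within `w`
of free sites of TWO DISTINCT cells (it sits in a wall of thickness `< 2w` separating cells: no pinned bulk, no pinned dust, no pinned sublattice
or isolated pin inside a cell); (6) SPARSE WALLS: around every `2ℓ`-deep clampable site the pinned sites are at most the fraction `8w/ℓ` of the
sites within `ℓ` (no interdigitated combs of thin tentacles of two cells with walls between them, which (2)–(5) alone would admit at pinned
fraction `t/(t+2)`) — see the four exclusion lemmas `not_cellSkeleton_of_stranded_pinned`, `…_of_oneSided_pinned`, `…_of_thin_deep_cell`,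
`…_of_dense_pinned`.  Hence what is pinned in `ℓ`-deep near matter is wall-like (two-sided, thickness `< 2w`), lies between fat cells, and has
local volume fraction `≤ 8w/ℓ → 0`.  Realised (CP's burden) by three families of pinned slabs `{0 < s < 43/10}` across a cubic grid of spacing
`ℓ/3` (`t = 4 ≤ 43/10`; every slab or junction site is within `43/10 + 3/2 ≤ w` of the cells on two sides, close-packed near matter having
covering radius `< 3/4`; slab fraction of an `ℓ`-ball `≈ 9·(43/10)/ℓ < 8w/ℓ`); record `(t, w) = (4, 6)` — `w = t` would leave no room for the
covering radius.  v1's clause «every clampable site within `ℓ` of a non-clampable site or of a free `ℓ/8`-ball» is DROPPED: it admitted free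
dust (reviewer q15651922). [this file] -/
def CellSkeleton (ℓ t w Rc θ₀ ρ₁ ε₁ θ δ : ℝ) (y : Fin N → E3) (F : Finset (Fin N)) : Prop :=
  F ⊆ nearInterior Rc θ₀ ρ₁ ε₁ θ δ y ∧
  ∃ c : Fin N → ℕ,
    (∀ i ∈ F, ∀ j ∈ F, c i = c j → dist (y i) (y j) ≤ ℓ) ∧
    (∀ i ∈ F, ∀ j ∈ F, c i ≠ c j → t ≤ dist (y i) (y j)) ∧
    (∀ i ∈ F, (∃ b, b ∉ nearInterior Rc θ₀ ρ₁ ε₁ θ δ y ∧ dist (y i) (y b) ≤ ℓ) ∨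
      ∃ m ∈ F, c m = c i ∧ ∀ j, dist (y j) (y m) ≤ ℓ / 8 → j ∈ F ∧ c j = c i) ∧
    (∀ k ∈ nearInterior Rc θ₀ ρ₁ ε₁ θ δ y, k ∉ F →
      (∃ b, b ∉ nearInterior Rc θ₀ ρ₁ ε₁ θ δ y ∧ dist (y k) (y b) ≤ ℓ) ∨
      ∃ i ∈ F, ∃ j ∈ F, c i ≠ c j ∧ dist (y k) (y i) ≤ w ∧ dist (y k) (y j) ≤ w) ∧
    (∀ k ∈ nearInterior Rc θ₀ ρ₁ ε₁ θ δ y, (∀ b, b ∉ nearInterior Rc θ₀ ρ₁ ε₁ θ δ y → 2 * ℓ < dist (y k) (y b)) →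
      ((Finset.univ.filter fun j => j ∉ F ∧ dist (y j) (y k) ≤ ℓ).card : ℝ)
        ≤ 8 * w / ℓ * ((Finset.univ.filter fun j => dist (y j) (y k) ≤ ℓ).card : ℝ))

/-- **Class-critical on `F`:** the class force of `z` for `y`'s classes (`Near y`, `G y`) vanishes at every free site. [this file] -/
def ClassCritical (θ₀ ρ₁ ε₁ θ δ : ℝ) (y z : Fin N → E3) (F : Finset (Fin N)) : Prop :=
  ∀ k ∈ F, classForce (nearSet θ₀ ρ₁ ε₁ θ δ y) (goodSet ρ₁ ε₁ θ δ y) z k = 0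

/-! ## §2b  What a skeleton cannot be (PROVED exclusion lemmas — the junk models of q15651922 / row 692 and their cousins) -/

/-- **No stranded pinned matter (PROVED):** a pinned clampable site deeper than `ℓ` (no non-clampable site within `ℓ`) and farther than `w`
from every free site contradicts clause (5).  Refutes, as skeletons, the reviewer's DUST (free balls of radius `ℓ/8` on a `0.9ℓ`-net: the
deep pinned bulk is `≈ 0.32ℓ > w` from `F` once `ℓ ≥ 19`), v1's `F = ∅` on `ℓ`-deep matter, and walls thicker than `2w`. [this file] -/
theorem not_cellSkeleton_of_stranded_pinned {ℓ t w Rc θ₀ ρ₁ ε₁ θ δ : ℝ} {y : Fin N → E3} {F : Finset (Fin N)}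
    (h : ∃ k ∈ nearInterior Rc θ₀ ρ₁ ε₁ θ δ y, k ∉ F ∧
      (∀ b, b ∉ nearInterior Rc θ₀ ρ₁ ε₁ θ δ y → ℓ < dist (y k) (y b)) ∧ (∀ i ∈ F, w < dist (y k) (y i))) :
    ¬ CellSkeleton ℓ t w Rc θ₀ ρ₁ ε₁ θ δ y F := by
  rintro ⟨-, c, -, -, -, h5, -⟩
  obtain ⟨k, hk, hkF, hdeep, hfar⟩ := h
  rcases h5 k hk hkF with ⟨b, hb, hbd⟩ | ⟨i, hi, j, -, -, hdi, -⟩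
  · exact absurd hbd (not_le.mpr (hdeep b hb))
  · exact absurd hdi (not_le.mpr (hfar i hi))

/-- **No one-sided pins (PROVED):** a deep pinned site all of whose free sites within `w` are pairwise closer than `t` (so, by (3), in ONE cell)
contradicts clause (5).  Refutes pinned sublattices and isolated pins inside a cell («salt-and-pepper»), which the one-sided wording «every
pinned site within `w` of a free site» would have admitted. [this file] -/
theorem not_cellSkeleton_of_oneSided_pinned {ℓ t w Rc θ₀ ρ₁ ε₁ θ δ : ℝ} {y : Fin N → E3} {F : Finset (Fin N)}
    (h : ∃ k ∈ nearInterior Rc θ₀ ρ₁ ε₁ θ δ y, k ∉ F ∧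
      (∀ b, b ∉ nearInterior Rc θ₀ ρ₁ ε₁ θ δ y → ℓ < dist (y k) (y b)) ∧
      (∀ i ∈ F, ∀ j ∈ F, dist (y k) (y i) ≤ w → dist (y k) (y j) ≤ w → dist (y i) (y j) < t)) :
    ¬ CellSkeleton ℓ t w Rc θ₀ ρ₁ ε₁ θ δ y F := by
  rintro ⟨-, c, -, h3, -, h5, -⟩
  obtain ⟨k, hk, hkF, hdeep, hone⟩ := h
  rcases h5 k hk hkF with ⟨b, hb, hbd⟩ | ⟨i, hi, j, hj, hcij, hdi, hdj⟩
  · exact absurd hbd (not_le.mpr (hdeep b hb))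
  · exact absurd (h3 i hi j hj hcij) (not_le.mpr (hone i hi j hj hdi hdj))

/-- **No foams of thin cells (PROVED):** a deep free site `i` such that every free `m` within `ℓ` of it has, within `ℓ/8`, a site that is pinned
or farther than `ℓ` from `i` contradicts clause (4) (by (2) the sites of `i`'s cell are within `ℓ` of `i`).  Refutes foams of small cells and
free dust packed at gaps `≥ t`: deep cells must contain a full `ℓ/8`-ball. [this file] -/
theorem not_cellSkeleton_of_thin_deep_cell {ℓ t w Rc θ₀ ρ₁ ε₁ θ δ : ℝ} {y : Fin N → E3} {F : Finset (Fin N)}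
    (h : ∃ i ∈ F, (∀ b, b ∉ nearInterior Rc θ₀ ρ₁ ε₁ θ δ y → ℓ < dist (y i) (y b)) ∧
      ∀ m ∈ F, dist (y i) (y m) ≤ ℓ → ∃ j, dist (y j) (y m) ≤ ℓ / 8 ∧ (j ∉ F ∨ ℓ < dist (y i) (y j))) :
    ¬ CellSkeleton ℓ t w Rc θ₀ ρ₁ ε₁ θ δ y F := by
  rintro ⟨-, c, h2, -, h4, -, -⟩
  obtain ⟨i, hi, hdeep, hthin⟩ := h
  rcases h4 i hi with ⟨b, hb, hbd⟩ | ⟨m, hm, hcm, hball⟩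
  · exact absurd hbd (not_le.mpr (hdeep b hb))
  · obtain ⟨j, hjm, hj⟩ := hthin m hm (h2 i hi m hm hcm.symm)
    obtain ⟨hjF, hcj⟩ := hball j hjm
    rcases hj with hjF' | hfar
    · exact hjF' hjF
    · exact absurd (h2 i hi j hjF hcj.symm) (not_le.mpr hfar)

/-- **No dense pinning (PROVED):** a `2ℓ`-deep clampable site around which more than the fraction `8w/ℓ` of the sites within `ℓ` are pinned
contradicts clause (6).  Refutes interdigitated COMBS (thin tentacles of two cells alternating with `t`-walls: local pinned fraction
`t/(t+2) = 2/3`), hairy cells, lasagna of thin sheets, and again dust / foam / bulk pinning, at every scale `ℓ > 12w`. [this file] -/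
theorem not_cellSkeleton_of_dense_pinned {ℓ t w Rc θ₀ ρ₁ ε₁ θ δ : ℝ} {y : Fin N → E3} {F : Finset (Fin N)}
    (h : ∃ k ∈ nearInterior Rc θ₀ ρ₁ ε₁ θ δ y, (∀ b, b ∉ nearInterior Rc θ₀ ρ₁ ε₁ θ δ y → 2 * ℓ < dist (y k) (y b)) ∧
      8 * w / ℓ * ((Finset.univ.filter fun j => dist (y j) (y k) ≤ ℓ).card : ℝ)
        < ((Finset.univ.filter fun j => j ∉ F ∧ dist (y j) (y k) ≤ ℓ).card : ℝ)) :
    ¬ CellSkeleton ℓ t w Rc θ₀ ρ₁ ε₁ θ δ y F := by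
  rintro ⟨-, c, -, -, -, -, h6⟩
  obtain ⟨k, hk, hdeep, hdense⟩ := h
  exact absurd (h6 k hk hdeep) (not_le.mpr hdense)

/-! ## §3  The two pieces -/

/-- **CP · `NearSkeletonEquilibrium η R Rc δm ρ₁ θ θ₀ t w`** (NEW · TRUE-type · ATTACKABLE-M; the REDUCTION half of the lens).  Given the
K-margins `K_at⁰` and R_aff: there is a minimal scale `ℓ₁` such that for every `ℓ ≥ ℓ₁` some `ε₀ > 0` works for all `ε₁ ≤ ε₀` and all windows:
every injective configuration admits a cell skeleton `F` of scale `ℓ` (gap `t`, wall half-width `w`, v2 clauses (2)–(5)) and a SKELETON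
EQUILIBRIUM `z` — `z = y` off `F`, class-critical on `F`, `RefAdmissible`.  Skeleton near boundaries (v2): pinned slabs `{0 < s < 43/10}` along a
cubic grid of spacing `ℓ/3`; cells := clampable sites of the open grid cubes containing a site deeper than `ℓ − 6`; all other clampable sites
pinned — each is a slab/junction site within `43/10 + 3/2 ≤ w` of two cells, or lies in or next to a cube with no site deeper than `ℓ − 6`, hence
within `ℓ` of a non-clampable site; cells of cubes with a site deeper than `ℓ − 6` contain the full `ℓ/8`-ball about their centre site (`ℓ ≥ 72`);
around a `2ℓ`-deep site every grid cube is a cell, so the pinned sites within `ℓ` are slab sites, a fraction `≈ 9·(43/10)/ℓ ≤ 8w/ℓ` (clause (6)).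
Equilibrium: cellwise finite-dimensional minimisation of `Φ_y` over a compact convex admissible set; the `t`-gap makes the inter-cell coupling
an LJ tail, K_at⁰ per cell gives `sup |∇(z − y)| ≤ C ε₁ ℓ⁴/μ₁` uniformly in `N`, so the minimiser is interior (critical) and (a),(c),(d) hold for
`ε₁ ≤ ε₀(ℓ)`.  WHY IT MIGHT FAIL: the chart room `η − θ₀ − C ε₁` in clause (d) at the record literals; nothing else (every constant may be
polynomial in `ℓ`). [lens-4 g45/g46; E–Ming 2007 §§4–6 (local minimisers near Cauchy–Born data), Ortner–Theil 2013 Thm 3.3 (stability ⇒ local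
existence), Ehrlacher–Ortner–Shapeev 2016 §2 (cell problems with clamped far field)] -/
def NearSkeletonEquilibrium (η R Rc δm ρ₁ θ θ₀ t w : ℝ) : Prop :=
  (∃ μ₁ μR : ℝ, 0 < μ₁ ∧ 0 < μR ∧ PureMarginStabilityAt η μ₁ μR R) → AffineChartStraightening →
    ∃ ℓ₁ : ℝ, ∀ ℓ : ℝ, ℓ₁ ≤ ℓ →
      ∃ ε₀ : ℝ, 0 < ε₀ ∧ ∀ ε₁ : ℝ, 0 < ε₁ → ε₁ ≤ ε₀ → ∀ δ : ℝ, 0 < δ → δ ≤ 2 →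
        ∀ (N : ℕ) (y : Fin N → E3), Function.Injective y →
          ∃ (F : Finset (Fin N)) (z : Fin N → E3), CellSkeleton ℓ t w Rc θ₀ ρ₁ ε₁ θ δ y F ∧ (∀ k, y k ≠ z k → k ∈ F) ∧
            ClassCritical θ₀ ρ₁ ε₁ θ δ y z F ∧ RefAdmissible η R Rc δm θ₀ ρ₁ ε₁ θ δ y z

/-- **R0 · `NearSkeletonFloor η R Rc δm ρ₁ θ θ₀ κ₁ t w`** (NEW · TRUE-type on paper · ATTACKABLE-L · UNDECIDED, tests = census (B)(iii)
re-pointed and the wall-load rows of the g46 memo; the NORMAL-FORM half of the lens: «no counterexample among skeleton equilibria»).  Given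
K_at⁰ and R_aff: for every `ν > 0` there is a scale `ℓ₀(ν)` such that for every `ℓ ≥ ℓ₀` some `ε₀ > 0` works (all `ε₁ ≤ ε₀`, all windows, some
`C ≥ 0`): for EVERY injective `y` and EVERY admissible skeleton equilibrium `(F, z)` of scale `ℓ` (v2 clauses),
`#Near·e⋆ − C·#Gᶜ − κ₁·#Far − ν·Q₁(y, z) ≤ ½·pairSum Near G z`.
What is floored, truthfully (v2): configurations RELAXED (class-critical) on fat cells of inradius `≥ ℓ/8` filling the `ℓ`-deep near matter,
and equal to the raw `y` only on two-sided walls of thickness `< 2w` between cells — local volume fraction `≤ 8w/ℓ`, so `→ 0` along the scale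
order `ν → ℓ₀(ν) ≤ ℓ` — and on the `ℓ`-collar of the near boundary (chargeable: every collar
site is within `ℓ + Rc + 1` of far/bad matter, `#collar ≤ C(ℓ)·(#Far + #Gᶜ)`, loss `≤ C·ε₁` each, `ε₀ = ε₀(ℓ)`).  Route and leak census: g45 memo
§3 (sitewise affine equation of state with force-weighted charts; wall bumps signed by K_at⁰; leaks `∝ J², K²` or collar-supported; scale order
`ν → ℓ → ε₀`).  WHY IT MIGHT FAIL: zero per-near-site budget in the deep bulk — any leak not of those kinds breaks the bookkeeping; sharpest
instance (g46): thin (`d ≲ 10`) loaded layers or fold lines of `y` ADJACENT to a wall, where reaction × jitter cross terms and kink losses meet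
the load-induced surplus at `O(1)` ratios `c/(2μ₁ t d)`, `c d t/|G|`. [lens-4 g45/g46; Blanc–Le Bris–Lions 2002 (Cauchy–Born from atomistic
equilibria), E–Ming 2007 Thm 2.2, Theil 2006 / Flatley–Theil 2015 (LJ lattice equation of state, `e⋆` attained by a Barlow packing at `d⋆`),
Hudson–Ortner 2014 §4 (locality of equilibrium corrections)] -/
def NearSkeletonFloor (η R Rc δm ρ₁ θ θ₀ κ₁ t w : ℝ) : Prop :=
  (∃ μ₁ μR : ℝ, 0 < μ₁ ∧ 0 < μR ∧ PureMarginStabilityAt η μ₁ μR R) → AffineChartStraightening →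
    ∀ ν : ℝ, 0 < ν → ∃ ℓ₀ : ℝ, ∀ ℓ : ℝ, ℓ₀ ≤ ℓ →
      ∃ ε₀ : ℝ, 0 < ε₀ ∧ ∀ ε₁ : ℝ, 0 < ε₁ → ε₁ ≤ ε₀ → ∀ δ : ℝ, 0 < δ → δ ≤ 2 →
        ∃ C : ℝ, 0 ≤ C ∧ ∀ (N : ℕ) (y : Fin N → E3), Function.Injective y →
          ∀ (F : Finset (Fin N)) (z : Fin N → E3), CellSkeleton ℓ t w Rc θ₀ ρ₁ ε₁ θ δ y F → (∀ k, y k ≠ z k → k ∈ F) →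
            ClassCritical θ₀ ρ₁ ε₁ θ δ y z F → RefAdmissible η R Rc δm θ₀ ρ₁ ε₁ θ δ y z →
              ((nearSet θ₀ ρ₁ ε₁ θ δ y).card : ℝ) * (⨅ Q : PeriodicConfiguration 3, Q.energyPerParticle lennardJones)
                - C * (((goodSet ρ₁ ε₁ θ δ y)ᶜ).card : ℝ) - κ₁ * ((farSet θ₀ ρ₁ ε₁ θ δ y).card : ℝ)
                - ν * dispGradSum (101 / 100) (nearSet θ₀ ρ₁ ε₁ θ δ y) (goodSet ρ₁ ε₁ θ δ y) y z
                ≤ 1 / 2 * pairSum (nearSet θ₀ ρ₁ ε₁ θ δ y) (goodSet ρ₁ ε₁ θ δ y) z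

/-! ## §4  The seam (PROVED), the degenerate case (both directions) and the record cone -/

/-- **SEAM (PROVED): K-side → CP → R0 → RD0c.**  Given `ν`, take the scale `ℓ := max ℓ₀(ν) ℓ₁` and `ε₀ := min`; CP supplies the skeleton
equilibrium, `firstSum = 0` by `firstSum_eq_zero_of_classCritical`, R0 supplies the floor. [this file] -/
theorem nearReferenceCritical_of_skeleton {η R Rc δm ρ₁ θ θ₀ κ₁ t w : ℝ}
    (hK : ∃ μ₁ μR : ℝ, 0 < μ₁ ∧ 0 < μR ∧ PureMarginStabilityAt η μ₁ μR R)
    (hCP : NearSkeletonEquilibrium η R Rc δm ρ₁ θ θ₀ t w) (hR0 : NearSkeletonFloor η R Rc δm ρ₁ θ θ₀ κ₁ t w) :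
    NearReferenceCriticalFloor η R Rc δm ρ₁ θ θ₀ κ₁ := by
  intro hR ν hν
  obtain ⟨ℓ₁, hCP'⟩ := hCP hK hR
  obtain ⟨ℓ₀, hR0'⟩ := hR0 hK hR ν hν
  obtain ⟨ε₀a, hε₀a, hA⟩ := hCP' (max ℓ₀ ℓ₁) (le_max_right _ _)
  obtain ⟨ε₀b, hε₀b, hB⟩ := hR0' (max ℓ₀ ℓ₁) (le_max_left _ _)
  refine ⟨min ε₀a ε₀b, lt_min hε₀a hε₀b, fun ε₁ hε₁ hle δ hδ hδ2 => ?_⟩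
  obtain ⟨C, hC, hB'⟩ := hB ε₁ hε₁ (hle.trans (min_le_right _ _)) δ hδ hδ2
  refine ⟨C, hC, fun N y hy => ?_⟩
  obtain ⟨F, z, hsk, hsupp, hcrit, hadm⟩ := hA ε₁ hε₁ (hle.trans (min_le_left _ _)) δ hδ hδ2 N y hy
  exact ⟨z, hadm, firstSum_eq_zero_of_classCritical hsupp hcrit, hB' N y hy F z hsk hsupp hcrit hadm⟩

/-- **Degenerate case, forward (PROVED):** if the clampable interior is `ℓ`-THIN — every clampable site within `ℓ` of a non-clampable one — then
`F = ∅` is a cell skeleton (and `z = y` a skeleton equilibrium: `classCritical_empty`, the tree's `refAdmissible_self`); R0 then asks N's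
inequality for such `y`, the boundary-dominated case: `#Near ≤ C(ℓ, Rc)·(#Far + #Gᶜ)`, sitewise loss `≤ C ε₁`, `ε₀ = ε₀(ℓ)`. [this file] -/
theorem cellSkeleton_empty {ℓ t w Rc θ₀ ρ₁ ε₁ θ δ : ℝ} {y : Fin N → E3}
    (h : ∀ k ∈ nearInterior Rc θ₀ ρ₁ ε₁ θ δ y, ∃ b, b ∉ nearInterior Rc θ₀ ρ₁ ε₁ θ δ y ∧ dist (y k) (y b) ≤ ℓ) :
    CellSkeleton ℓ t w Rc θ₀ ρ₁ ε₁ θ δ y ∅ :=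
  ⟨Finset.empty_subset _, fun _ => 0, by simp, by simp, by simp, fun k hk _ => Or.inl (h k hk), fun k hk hdeep => by
    obtain ⟨b, hb, hbd⟩ := h k hk
    have h2 := hdeep b hb
    have hd : 0 ≤ dist (y k) (y b) := dist_nonneg
    exfalso
    linarith⟩

/-- **Degenerate case, converse (PROVED):** if `F = ∅` is a cell skeleton then the clampable interior is `ℓ`-thin.  So v2's empty skeleton is
EXACTLY the boundary-dominated case, in both directions (v1's was «`ℓ`-thin» forward only, and v1 admitted dust besides). [this file] -/
theorem nearInterior_thin_of_cellSkeleton_empty {ℓ t w Rc θ₀ ρ₁ ε₁ θ δ : ℝ} {y : Fin N → E3}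
    (h : CellSkeleton ℓ t w Rc θ₀ ρ₁ ε₁ θ δ y ∅) :
    ∀ k ∈ nearInterior Rc θ₀ ρ₁ ε₁ θ δ y, ∃ b, b ∉ nearInterior Rc θ₀ ρ₁ ε₁ θ δ y ∧ dist (y k) (y b) ≤ ℓ := by
  obtain ⟨-, c, -, -, -, h5, -⟩ := h
  intro k hk
  rcases h5 k hk (by simp) with hb | ⟨i, hi, -⟩
  · exact hb
  · simp at hi

/-- `z = y` is class-critical on the empty skeleton and supported in it (PROVED, trivial). [this file] -/
theorem classCritical_empty {θ₀ ρ₁ ε₁ θ δ : ℝ} (y : Fin N → E3) :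
    ClassCritical θ₀ ρ₁ ε₁ θ δ y y ∅ ∧ ∀ k, y k ≠ y k → k ∈ (∅ : Finset (Fin N)) :=
  ⟨fun k hk => absurd hk (by simp), fun k hk => absurd rfl hk⟩

/-- **LINE CONE through the skeleton at the record literals** `(η, R, Rc, δm, ρ₁, θ, θ₀, κ₁, t, w) = (3/2000, 4, 6, 1/1000, 12, 1/25, 1/2000,
1/(4·10⁷), 4, 6)` through the tree's cone of record `tbdsg_of_nearCritical_record'_bt_d` (p840951; BT and D discharged):
`K_at⁰ ∧ R_aff ∧ CP ∧ R0 ∧ N2 ∧ Z ∧ M ⟹ TameBalancedDeepScaleGap (122/125) 0 4 (3/50) (1/450)`. [this file] -/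
theorem tbdsg_of_nearSkeleton_record
    (hK : ∃ μ₁ μR : ℝ, 0 < μ₁ ∧ 0 < μR ∧ PureMarginStabilityAt (3 / 2000) μ₁ μR 4) (hR : AffineChartStraightening)
    (hCP : NearSkeletonEquilibrium (3 / 2000) 4 6 (1 / 1000) 12 (1 / 25) (1 / 2000) 4 6)
    (hR0 : NearSkeletonFloor (3 / 2000) 4 6 (1 / 1000) 12 (1 / 25) (1 / 2000) (1 / (4 * 10 ^ 7)) 4 6)
    (h2 : NearSecondOrderFloor (3 / 2000) 4 6 (1 / 1000) 12 (1 / 25) (1 / 2000) (1 / (4 * 10 ^ 7)))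
    (hZ : FarAggregatePricing 12 (1 / 25) (1 / 2000) (1 / (2 * 10 ^ 7))) (hM : AffMidAll 12 (1 / 25)) :
    TameBalancedDeepScaleGap (122 / 125) 0 4 (3 / 50) (1 / 450) :=
  tbdsg_of_nearCritical_record'_bt_d hK hR (nearReferenceCritical_of_skeleton hK hCP hR0) h2 hZ hM

/-- **The residual RDEF through the skeleton** (record shape of the tree's `rdef_of_ceg_shape_nearOrders`, slot 3 now
`K_at⁰ ∧ R_aff ∧ CP ∧ R0 ∧ N2 ∧ Z ∧ M`; CEG, T, CE, Res are the other RDEF slots). [this file] -/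
theorem rdef_of_ceg_shape_nearSkeleton_record (hCEG : ChargedEnergyGap) (hT : TwoShellShape (1 / 100) (3 / 50) (1 / 450))
    (hK : ∃ μ₁ μR : ℝ, 0 < μ₁ ∧ 0 < μR ∧ PureMarginStabilityAt (3 / 2000) μ₁ μR 4) (hR : AffineChartStraightening)
    (hCP : NearSkeletonEquilibrium (3 / 2000) 4 6 (1 / 1000) 12 (1 / 25) (1 / 2000) 4 6)
    (hR0 : NearSkeletonFloor (3 / 2000) 4 6 (1 / 1000) 12 (1 / 25) (1 / 2000) (1 / (4 * 10 ^ 7)) 4 6)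
    (h2 : NearSecondOrderFloor (3 / 2000) 4 6 (1 / 1000) 12 (1 / 25) (1 / 2000) (1 / (4 * 10 ^ 7)))
    (hZ : FarAggregatePricing 12 (1 / 25) (1 / 2000) (1 / (2 * 10 ^ 7))) (hM : AffMidAll 12 (1 / 25))
    (hCE : CleanlessExcessT) (hRes : CoherentResidual 10) : RobustDefectLimitWindows :=
  rdef_of_ceg_shape_balancedDeep_record hCEG hT (tbdsg_of_nearSkeleton_record hK hR hCP hR0 h2 hZ hM) hCE hRes

end Summit.AtomisticToContinuum.Crystallization.Theorems.OverbindingBudgetAffineNearCluster
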